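import Summits.Ventures.Crystal3D.Theorems.StickyWulffConstantGenericWallFloorStarTransport
import Summits.Ventures.Crystal3D.Theorems.StickyWulffConstantGenericWallFloorCubicCoords
import Summits.Ventures.Crystal3D.Theorems.StickyWulffConstantGenericWallFloorSharedOrthogonal
import HarnessLib

/-!
# The STAR LEMMA: a ball carrying the closed vertex star of `−u` sees every other neighbour strictly
# above the equator of `u` — except the two equatorial slots (crux `GenericWallFloor`, line `WallLedgerG`)

HONEST FRAMING. Part of the venture `Summits/Ventures/Crystal3D` (cell `crystal3d-full`), helper
`--supports` the crux `GenericWallFloor` (stmt-Ventures-19480) of `route-Ventures-StickyWulffConstant`,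
registered line `WallLedgerG`, open stub `stub_twoSlabAdhesion`.  Input for the DOUBLE-TOP residual `#DT`
of the chain ledger (`twoSlabAdhesion_chainLedger`, …ChainLedger; cf-p1 ROUTE §81(3) «deficiencies of
distinct balls add» needs that a ball claimed by BOTH grains' line families pays twice).

* `star_coords` — the real-arithmetic core: for a unit vector `(a, b, c)` with `−a−b ≤ √2/2`,
  `−a ± c ≤ √2/2`, `−b ± c ≤ √2/2` one has `a + b > 0`, or `a + b = 0 ∧ c = 0`.
* `inner_slotSite` — `⟪slotSite k, slotSite l⟫ = (slotInt k · slotInt l)/2` (cubic coordinates);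
  `card_star_eq_five` — the closed vertex star `{w ∈ fccSlots | 0 < ⟪w, s⟫}` of a slot has five members.
* **`star_lemma`** — for a frame `A`, a slot `u` and a unit vector `y` with `⟪y, A s⟫ ≤ ½` for every
  slot `s` of the closed vertex star of `−u` (`⟪s, u⟫ < 0`; i.e. the ball at `e + y` keeps distance `≥ 1`
  from the five star balls `e + A s`): `⟪y, A u⟫ > 0`, or `y = A q` for a slot `q ⊥ u`.
  (Proof: slot transitivity `exists_latticeIso_map_slot` to the slot `(1,1,0)/√2`, cubic coordinates,
  `star_coords`; the equality case pins `y` to `±(1,−1,0)/√2`.)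
* **`card_neighbours_le_ten_of_antipodal_stars`** — in a `1`-separated `X`, a ball `e` carrying the
  closed vertex star of `−u₁` in frame `A₁` AND of `−u₂` in frame `A₂` with `A₁ u₁ = −A₂ u₂` (an
  ANTIPODAL DOUBLE TOP: exit of grain 1 upward along `u₁` and of grain 2 downward along `u₂` on one line)
  has AT MOST TEN contacts unless the two linear lattices coincide: any eleventh neighbour would be a
  common slot vector orthogonal to the common slot `A₁ u₁`, and two orthogonal shared slots force
  `A₁·Λ₀ = A₂·Λ₀` (`eq_of_shared_orthogonal_slots`, wulff-p2).  So such a ball pays `12 − deg ≥ 2`, once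
  to each line family — the `[110]`-twist / straight-column case of `#DT` costs nothing.

WHAT THIS IS NOT: tilted double tops (`A₁u₁ ≠ −A₂u₂`, locally feasible up to ≈30° by the seat's numerics)
are not treated; no ledger re-weighting here; rung F-C1 not moved.
-/

noncomputable section

namespace Summit.Ventures.Crystal3D.Theorems

open Summit.Ventures.Crystal3D Finset NearIdentity
open Literature.MathematicalPhysics.StatisticalMechanics (fccStacking)
open scoped InnerProductSpace

/-! ### The real-arithmetic core -/

/-- **Star inequality in coordinates.**  A unit vector `(a,b,c)` at inner product `≤ ½` with the five
unit vectors `(−1,−1,0)/√2`, `(−1,0,±1)/√2`, `(0,−1,±1)/√2` has `a + b > 0`, or `a + b = 0` and `c = 0`. -/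
theorem star_coords {a b c : ℝ} (h1 : a ^ 2 + b ^ 2 + c ^ 2 = 1) (hp : -a - b ≤ Real.sqrt 2 / 2)
    (h2 : -a + c ≤ Real.sqrt 2 / 2) (h3 : -a - c ≤ Real.sqrt 2 / 2) (h4 : -b + c ≤ Real.sqrt 2 / 2)
    (h5 : -b - c ≤ Real.sqrt 2 / 2) : 0 < a + b ∨ (a + b = 0 ∧ c = 0) := by
  by_cases hab : 0 < a + b
  · exact Or.inl hab
  right
  push Not at hab
  set s : ℝ := Real.sqrt 2 / 2 with hs
  have hs2 : s ^ 2 = 1 / 2 := by rw [hs, div_pow, Real.sq_sqrt (by norm_num)]; norm_num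
  have hs0 : 0 < s := by positivity
  -- `a, b ∈ [±c − s, s ∓ c]`
  have ha2 : a ≤ s - c := by linarith only [hab, h4]
  have ha2' : a ≤ s + c := by linarith only [hab, h5]
  have hb2 : b ≤ s - c := by linarith only [hab, h2]
  have hb2' : b ≤ s + c := by linarith only [hab, h3]
  -- hence `c = 0`
  have hc : c = 0 := by
    by_contra hc
    rcases lt_or_gt_of_ne hc with hneg | hpos
    · -- `c < 0`: `a, b ∈ [−c − s, s + c]`
      have haa : 0 ≤ (s + c - a) * (a + (s + c)) := mul_nonneg (by linarith only [ha2']) (by linarith only [h3])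
      have hbb : 0 ≤ (s + c - b) * (b + (s + c)) := mul_nonneg (by linarith only [hb2']) (by linarith only [h5])
      have hcs : 0 < 4 * s + 3 * c := by linarith only [ha2', h3, hs0]
      have hcc : 0 < -c * (4 * s + 3 * c) := mul_pos (by linarith only [hneg]) hcs
      linarith only [haa, hbb, hcc, h1, hs2]
    · have haa : 0 ≤ (s - c - a) * (a + (s - c)) := mul_nonneg (by linarith only [ha2]) (by linarith only [h2])
      have hbb : 0 ≤ (s - c - b) * (b + (s - c)) := mul_nonneg (by linarith only [hb2]) (by linarith only [h4])
      have hcs : 0 < 4 * s - 3 * c := by linarith only [ha2, h2, hs0]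
      have hcc : 0 < c * (4 * s - 3 * c) := mul_pos hpos hcs
      linarith only [haa, hbb, hcc, h1, hs2]
  subst hc
  refine ⟨?_, rfl⟩
  have haa : 0 ≤ (s - a) * (a + s) := mul_nonneg (by linarith only [ha2]) (by linarith only [h2])
  have hbb : 0 ≤ (s - b) * (b + s) := mul_nonneg (by linarith only [hb2]) (by linarith only [h4])
  have ha : a ^ 2 = 1 / 2 := by linarith only [haa, hbb, h1, hs2]
  have hb : b ^ 2 = 1 / 2 := by linarith only [haa, hbb, h1, hs2]
  -- `(a + b)(a − b) = 0`; `a = b` would force `a = b = −s` and break the pole constraint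
  have hprod : (a + b) * (a - b) = 0 := by
    have : (a + b) * (a - b) = a ^ 2 - b ^ 2 := by ring
    rw [this, ha, hb, sub_self]
  rcases mul_eq_zero.1 hprod with h | h
  · exact h
  · exfalso
    have hab' : b = a := by linarith only [h]
    subst hab'
    have ha0 : b ≤ 0 := by linarith only [hab]
    -- `b = −s`
    have hbs : 0 ≤ (-b - s) * (s - b) := by nlinarith only [ha, hs2, ha0, hs0]
    have : (b + s) * (b + s) = 0 := by nlinarith only [ha, hs2, hbs, ha0, hs0]
    have hbs' : b = -s := by
      have := mul_self_eq_zero.1 this; linarith only [this]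
    subst hbs'
    linarith only [hp, hs0]

/-! ### Slots in cubic coordinates -/

/-- `⟪slotSite k, slotSite l⟫ = (slotInt k · slotInt l) / 2`. -/
theorem inner_slotSite (k l : Fin 12) :
    ⟪slotSite k, slotSite l⟫_ℝ = ((slotInt k ⬝ᵥ slotInt l : ℤ) : ℝ) / 2 := by
  rw [inner_eq_cubicCoords, cubicCoords_slotSite, cubicCoords_slotSite]
  simp only [slotVec, dotProduct, Fin.sum_univ_three]
  have hs : Real.sqrt 2 ^ 2 = 2 := Real.sq_sqrt (by norm_num)
  push_cast
  field_simp
  rw [hs]; ring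

/-- The inner product of a vector with a slot, in cubic coordinates. -/
theorem inner_slotSite_right (x : EuclideanSpace ℝ (Fin 3)) (k : Fin 12) :
    ⟪x, slotSite k⟫_ℝ = (cubicCoords x 0 * slotInt k 0 + cubicCoords x 1 * slotInt k 1 +
      cubicCoords x 2 * slotInt k 2) / Real.sqrt 2 := by
  rw [inner_eq_cubicCoords, cubicCoords_slotSite]
  simp only [slotVec, dotProduct, Fin.sum_univ_three]
  ring

/-- The squared norm in cubic coordinates. -/
theorem norm_sq_eq_cubicCoords_sum (x : EuclideanSpace ℝ (Fin 3)) :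
    ‖x‖ ^ 2 = cubicCoords x 0 ^ 2 + cubicCoords x 1 ^ 2 + cubicCoords x 2 ^ 2 := by
  rw [norm_sq_eq_cubicCoords]; simp only [dotProduct, Fin.sum_univ_three]; ring

/-- **The closed vertex star of a slot has five members.** -/
theorem card_star_eq_five {s : EuclideanSpace ℝ (Fin 3)} (hs : s ∈ fccSlots) :
    (fccSlots.filter fun w => 0 < ⟪w, s⟫_ℝ).card = 5 := by
  classical
  obtain ⟨g, hg, hg', hgs⟩ := exists_latticeIso_map_slot (slotSite_mem 0) hs
  rw [← hgs, ← image_star_eq g hg hg' (slotSite 0), Finset.card_image_of_injective _ g.injective,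
    fccSlots_eq_image, Finset.filter_image, Finset.card_image_of_injective _ slotSite_injective]
  have key : (Finset.univ.filter fun k : Fin 12 => 0 < ⟪slotSite k, slotSite 0⟫_ℝ) =
      Finset.univ.filter fun k : Fin 12 => 0 < slotInt k ⬝ᵥ slotInt 0 := by
    ext k
    simp only [Finset.mem_filter, Finset.mem_univ, true_and, inner_slotSite]
    constructor
    · intro h; exact_mod_cast (by linarith : (0 : ℝ) < (slotInt k ⬝ᵥ slotInt 0 : ℤ))
    · intro h; have : (0 : ℝ) < ((slotInt k ⬝ᵥ slotInt 0 : ℤ) : ℝ) := by exact_mod_cast h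
      linarith
  rw [key]; decide

/-! ### The star lemma -/

/-- **STAR LEMMA.**  Let `A` be a frame, `u` a slot and `y` a unit vector with `⟪y, A s⟫ ≤ ½` for every
slot `s` with `⟪s, u⟫ < 0` (the closed vertex star of `−u`: `−u` and its four neighbours).  Then
`⟪y, A u⟫ > 0`, or `y = A q` for a slot `q` orthogonal to `u` (one of the two equatorial slots). -/
theorem star_lemma (A : EuclideanSpace ℝ (Fin 3) ≃ₗᵢ[ℝ] EuclideanSpace ℝ (Fin 3))
    {u : EuclideanSpace ℝ (Fin 3)} (hu : u ∈ fccSlots) {y : EuclideanSpace ℝ (Fin 3)} (hy : ‖y‖ = 1)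
    (hstar : ∀ s ∈ fccSlots, ⟪s, u⟫_ℝ < 0 → ⟪y, A s⟫_ℝ ≤ 1 / 2) :
    0 < ⟪y, A u⟫_ℝ ∨ ∃ q ∈ fccSlots, ⟪q, u⟫_ℝ = 0 ∧ y = A q := by
  obtain ⟨g, hg, hg', hgs⟩ := exists_latticeIso_map_slot (slotSite_mem 0) hu
  -- pull back: `Y = g⁻¹ A⁻¹ y`
  set Y : EuclideanSpace ℝ (Fin 3) := g.symm (A.symm y) with hY
  have hyY : y = A (g Y) := by rw [hY]; simp
  have hYn : ‖Y‖ = 1 := by rw [hY, LinearIsometryEquiv.norm_map, LinearIsometryEquiv.norm_map, hy]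
  have hin : ∀ k : Fin 12, ⟪y, A (g (slotSite k))⟫_ℝ = ⟪Y, slotSite k⟫_ℝ := by
    intro k; rw [hyY, LinearIsometryEquiv.inner_map_map, LinearIsometryEquiv.inner_map_map]
  have hsu : ∀ k : Fin 12, ⟪g (slotSite k), u⟫_ℝ = ⟪slotSite k, slotSite 0⟫_ℝ := by
    intro k; rw [← hgs, LinearIsometryEquiv.inner_map_map]
  -- the five star constraints in cubic coordinates `(a, b, c)` of `Y`
  have hcon : ∀ k : Fin 12, slotInt k ⬝ᵥ slotInt 0 < 0 → ⟪Y, slotSite k⟫_ℝ ≤ 1 / 2 := by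
    intro k hk
    have hneg : ⟪g (slotSite k), u⟫_ℝ < 0 := by
      rw [hsu, inner_slotSite]
      have : ((slotInt k ⬝ᵥ slotInt 0 : ℤ) : ℝ) < 0 := by exact_mod_cast hk
      linarith
    have := hstar _ (map_mem_fccSlots g hg (slotSite_mem k)) hneg
    rwa [hin] at this
  set a := cubicCoords Y 0 with ha
  set b := cubicCoords Y 1 with hb
  set c := cubicCoords Y 2 with hc
  have hs2 : (0 : ℝ) < Real.sqrt 2 := by positivity
  have hss : Real.sqrt 2 * Real.sqrt 2 = 2 := Real.mul_self_sqrt (by norm_num)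
  have h1 : a ^ 2 + b ^ 2 + c ^ 2 = 1 := by rw [ha, hb, hc, ← norm_sq_eq_cubicCoords_sum, hYn, one_pow]
  -- k = 3: (−1,−1,0); 6: (−1,0,1); 7: (−1,0,−1); 10: (0,−1,1); 11: (0,−1,−1)
  have e3 := hcon 3 (by decide)
  have e6 := hcon 6 (by decide)
  have e7 := hcon 7 (by decide)
  have e10 := hcon 10 (by decide)
  have e11 := hcon 11 (by decide)
  rw [inner_slotSite_right] at e3 e6 e7 e10 e11
  simp only [slotInt, Matrix.cons_val_zero, Matrix.cons_val_one, Matrix.cons_val,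
    Int.cast_one, Int.cast_zero, Int.cast_neg, ← ha, ← hb, ← hc] at e3 e6 e7 e10 e11
  have bound : ∀ t : ℝ, t / Real.sqrt 2 ≤ 1 / 2 → t ≤ Real.sqrt 2 / 2 := by
    intro t ht
    rw [div_le_iff₀ hs2] at ht
    have : Real.sqrt 2 / 2 = 1 / 2 * Real.sqrt 2 := by ring
    rw [this]; exact ht
  have hp : -a - b ≤ Real.sqrt 2 / 2 := bound _ (by convert e3 using 2; ring)
  have h2 : -a + c ≤ Real.sqrt 2 / 2 := bound _ (by convert e6 using 2; ring)
  have h3 : -a - c ≤ Real.sqrt 2 / 2 := bound _ (by convert e7 using 2; ring)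
  have h4 : -b + c ≤ Real.sqrt 2 / 2 := bound _ (by convert e10 using 2; ring)
  have h5 : -b - c ≤ Real.sqrt 2 / 2 := bound _ (by convert e11 using 2; ring)
  -- `⟪y, A u⟫ = ⟪Y, slotSite 0⟫ = (a + b)/√2`
  have hyu : ⟪y, A u⟫_ℝ = (a + b) / Real.sqrt 2 := by
    rw [← hgs, hin 0, inner_slotSite_right]
    simp only [slotInt, Matrix.cons_val_zero, Matrix.cons_val_one, Matrix.cons_val, Int.cast_one,
      Int.cast_zero, ← ha, ← hb, ← hc]
    ring
  rcases star_coords h1 hp h2 h3 h4 h5 with hpos | ⟨hab, hc0⟩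
  · left; rw [hyu]; positivity
  · right
    -- `a + b = 0`, `c = 0`, `a² = ½`: `Y = ± slotSite 1` (cubic `(1,−1,0)/√2`)
    have ha2 : a ^ 2 = 1 / 2 := by nlinarith
    have hb' : b = -a := by linarith
    have key : ∀ k : Fin 12, cubicCoords Y = slotVec k → ∃ q ∈ fccSlots, ⟪q, u⟫_ℝ = 0 ∧ y = A q := by
      intro k hk
      have hYk : Y = slotSite k := cubicCoords_injective (by rw [hk, cubicCoords_slotSite])
      refine ⟨g (slotSite k), map_mem_fccSlots g hg (slotSite_mem k), ?_, by rw [hyY, hYk]⟩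
      have h0 : ⟪Y, slotSite 0⟫_ℝ = 0 := by
        have := hyu; rw [← hgs, hin 0] at this; rw [this, hab, zero_div]
      rw [hsu, ← hYk]; exact h0
    have hroot : a = Real.sqrt 2 / 2 ∨ a = -(Real.sqrt 2 / 2) := by
      have : (a - Real.sqrt 2 / 2) * (a + Real.sqrt 2 / 2) = 0 := by nlinarith
      rcases mul_eq_zero.1 this with h | h
      · exact Or.inl (by linarith)
      · exact Or.inr (by linarith)
    have hcY : cubicCoords Y = ![a, b, c] := by
      ext i; fin_cases i <;> simp [ha, hb, hc]
    have hq : Real.sqrt 2 / 2 = 1 / Real.sqrt 2 := by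
      rw [div_eq_div_iff (by norm_num) (ne_of_gt hs2), one_mul, hss]
    rcases hroot with hA | hA
    · refine key 1 ?_
      rw [hcY]; ext i
      fin_cases i <;> simp [slotVec, slotInt, hb', hc0, hA, hq, neg_div]
    · refine key 2 ?_
      rw [hcY]; ext i
      fin_cases i <;> simp [slotVec, slotInt, hb', hc0, hA, hq, neg_div]

/-! ### Antipodal double tops have at most ten contacts -/

/-- Unit vectors at distance `≥ 1` meet at inner product `≤ ½`. -/
theorem inner_le_half_of_norm_sub_ge_one {y v : EuclideanSpace ℝ (Fin 3)} (hy : ‖y‖ = 1) (hv : ‖v‖ = 1)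
    (h : 1 ≤ ‖y - v‖) : ⟪y, v⟫_ℝ ≤ 1 / 2 := by
  have h2 : ‖y - v‖ ^ 2 = 2 - 2 * ⟪y, v⟫_ℝ := by rw [norm_sub_sq_real, hy, hv]; ring
  nlinarith [h2, h]

open scoped Classical in
/-- **ANTIPODAL DOUBLE TOPS PAY TWICE.**  `X` `1`-separated; `e` carries the closed vertex star of `−u₁`
in the frame `A₁` and of `−u₂` in the frame `A₂` (`e + Aᵢ s ∈ X` whenever `⟪s, uᵢ⟫ < 0`), the two walk
vectors being antipodal, `A₁ u₁ + A₂ u₂ = 0` (grain 1 exits upward along `u₁`, grain 2 downward along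
`u₂`, on one line).  If the linear lattices `A₁·Λ₀ ≠ A₂·Λ₀` differ, `e` has at most TEN contacts: by the
star lemma any further neighbour direction is a common slot orthogonal to the common slot `A₁ u₁`, and two
orthogonal shared slots force `A₁·Λ₀ = A₂·Λ₀` (`eq_of_shared_orthogonal_slots`). -/
theorem card_neighbours_le_ten_of_antipodal_stars {X : Finset (EuclideanSpace ℝ (Fin 3))}
    (hX : ∀ p ∈ X, ∀ q ∈ X, p ≠ q → 1 ≤ dist p q)
    (A₁ A₂ : EuclideanSpace ℝ (Fin 3) ≃ₗᵢ[ℝ] EuclideanSpace ℝ (Fin 3))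
    (hne : A₁ '' fccStacking 1 (Real.sqrt (2 / 3)) ≠ A₂ '' fccStacking 1 (Real.sqrt (2 / 3)))
    {u₁ u₂ : EuclideanSpace ℝ (Fin 3)} (hu₁ : u₁ ∈ fccSlots) (hu₂ : u₂ ∈ fccSlots)
    (hanti : A₁ u₁ + A₂ u₂ = 0) {e : EuclideanSpace ℝ (Fin 3)}
    (hstar₁ : ∀ s ∈ fccSlots, ⟪s, u₁⟫_ℝ < 0 → e + A₁ s ∈ X)
    (hstar₂ : ∀ s ∈ fccSlots, ⟪s, u₂⟫_ℝ < 0 → e + A₂ s ∈ X) :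
    (X.filter fun q => dist e q = 1).card ≤ 10 := by
  set S₁ := (fccSlots.filter fun s => 0 < ⟪s, -u₁⟫_ℝ).image fun s => e + A₁ s with hS₁
  set S₂ := (fccSlots.filter fun s => 0 < ⟪s, -u₂⟫_ℝ).image fun s => e + A₂ s with hS₂
  have hc₁ : S₁.card ≤ 5 :=
    Finset.card_image_le.trans (card_star_eq_five (neg_mem_fccSlots hu₁)).le
  have hc₂ : S₂.card ≤ 5 :=
    Finset.card_image_le.trans (card_star_eq_five (neg_mem_fccSlots hu₂)).le
  have hA₂u₂ : A₂ u₂ = -A₁ u₁ := by rw [← add_eq_zero_iff_eq_neg.1 (by rwa [add_comm] at hanti)]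
  -- every neighbour is a star ball
  have hsub : (X.filter fun q => dist e q = 1) ⊆ S₁ ∪ S₂ := by
    intro q hq
    obtain ⟨hqX, hqd⟩ := Finset.mem_filter.1 hq
    by_contra hnot
    rw [Finset.mem_union, not_or] at hnot
    set y := q - e with hy
    have hyn : ‖y‖ = 1 := by rw [hy, ← dist_eq_norm, dist_comm]; exact hqd
    -- the star constraints
    have con : ∀ (A : EuclideanSpace ℝ (Fin 3) ≃ₗᵢ[ℝ] EuclideanSpace ℝ (Fin 3)) (u : EuclideanSpace ℝ (Fin 3)),
        (∀ s ∈ fccSlots, ⟪s, u⟫_ℝ < 0 → e + A s ∈ X) →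
        q ∉ (fccSlots.filter fun s => 0 < ⟪s, -u⟫_ℝ).image (fun s => e + A s) →
        ∀ s ∈ fccSlots, ⟪s, u⟫_ℝ < 0 → ⟪y, A s⟫_ℝ ≤ 1 / 2 := by
      intro A u hst hq' s hs hsu
      have hmem := hst s hs hsu
      have hne' : e + A s ≠ q := by
        intro h
        apply hq'
        exact Finset.mem_image.2 ⟨s, Finset.mem_filter.2 ⟨hs, by rw [inner_neg_right]; linarith⟩, h⟩
      have hd := hX _ hmem _ hqX hne'
      refine inner_le_half_of_norm_sub_ge_one hyn
        (by rw [LinearIsometryEquiv.norm_map, norm_eq_one_of_mem_fccSlots hs]) ?_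
      rw [dist_eq_norm] at hd
      rwa [hy, show q - e - A s = -(e + A s - q) by abel, norm_neg]
    have c₁ := con A₁ u₁ hstar₁ hnot.1
    have c₂ := con A₂ u₂ hstar₂ hnot.2
    rcases star_lemma A₁ hu₁ hyn c₁ with hpos₁ | ⟨q₁, hq₁, hq₁u, hyq₁⟩ <;>
      rcases star_lemma A₂ hu₂ hyn c₂ with hpos₂ | ⟨q₂, hq₂, hq₂u, hyq₂⟩
    · rw [hA₂u₂, inner_neg_right] at hpos₂; linarith
    · have : ⟪y, A₂ u₂⟫_ℝ = 0 := by rw [hyq₂, LinearIsometryEquiv.inner_map_map, hq₂u]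
      rw [hA₂u₂, inner_neg_right] at this; linarith
    · have : ⟪y, A₁ u₁⟫_ℝ = 0 := by rw [hyq₁, LinearIsometryEquiv.inner_map_map, hq₁u]
      rw [hA₂u₂, inner_neg_right] at hpos₂; linarith
    · -- `y = A₁ q₁ = A₂ q₂` and `A₁ u₁ = A₂ (−u₂)`: two orthogonal shared slots
      apply hne
      refine eq_of_shared_orthogonal_slots A₁ A₂ y (A₁ u₁)
        ⟨q₁, mem_fcc_of_mem_fccSlots hq₁, hyq₁.symm⟩ ⟨u₁, mem_fcc_of_mem_fccSlots hu₁, rfl⟩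
        ⟨q₂, mem_fcc_of_mem_fccSlots hq₂, hyq₂.symm⟩
        ⟨-u₂, mem_fcc_of_mem_fccSlots (neg_mem_fccSlots hu₂), by rw [map_neg, hA₂u₂, neg_neg]⟩ hyn
        (by rw [LinearIsometryEquiv.norm_map, norm_eq_one_of_mem_fccSlots hu₁]) ?_
      rw [hyq₁, LinearIsometryEquiv.inner_map_map, hq₁u]
  calc (X.filter fun q => dist e q = 1).card ≤ (S₁ ∪ S₂).card := Finset.card_le_card hsub
    _ ≤ S₁.card + S₂.card := Finset.card_union_le _ _
    _ ≤ 10 := by omega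

end Summit.Ventures.Crystal3D.Theorems

end
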